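import Literature.MathematicalPhysics.QuantumFieldTheory.Balaban1983to89.B8Prop5GaugeParamKLevelPer
import Literature.MathematicalPhysics.QuantumFieldTheory.Balaban1983to89.B8Prop5ContractionKLevelSrcPer

/-!
# [B8] Proposition 5's gauge parameter WITH A SOURCE (Theorem 8's (1.146)) ON THE TORUS — JOIN-A of the periodic × sourced existence stack
(B8-P5-NESTED-SERVER, existence instance (ii) «Theorem-8 source», layer E-ii-1)

Bałaban, *Comm. Math. Phys.* **99** (1985) 75–102 ([B8]; PDF page = printed page − 74): Prop. 5 (1.107)–(1.108) p. 94, (1.100)–(1.103) p. 93,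
Thm 8 (1.146) p. 101 («R D*(1∕iη) log U^{u⁻¹} = f»), (1.17) p. 78, p. 77 («Ω_j ⊂ T_η»), §3 p. 98.

WHY THIS FILE (lead g33's WAKE-B8P5NestedServerExist, instance order (ii): `LanF a U₀ φ m W := IsLandau146W … f W`, T6c's consumer).  The periodic
existence chain of record (`B8Prop5GaugeParamKLevelPer` → `B8Prop5JoinSectELocalRDTraceFreePer` → `B8SockHFPTraceFreePer`) is source-free; the sourced
chain (`B8Prop5GaugeParamKLevelSrc` → `B8Prop5JoinSectELocalRDSrc` → `B8SockHFPRDSrc`) is on `ℤᵈ`.  THIS FILE is their merge at the JOIN-A layer: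
★ `gaugeParam_kLevel_src_per` — t2s-1's `gaugeParam_kLevel_per` with dag-n05-d's source delta, on lit-balaban-p21's periodic sourced contraction
`B8Prop5ContractionKLevelSrcPer` (p660027).  Proof: the per proof token for token, the three contraction bricks swapped for their `_src_per` twins.

HONEST SCOPE.  Re-thread BY NAME; the contraction is n04-b's ∕ p21's; [4] ∕ [3] NOT proved (displayed hypotheses); count-neutral; N05 NOT discharged;
`T_η` read as `P`-periodic data on `ηℤᵈ`; one finite `T⁴` programme at fixed `ε` — nothing continuum ∕ ℝ⁴ ∕ OS ∕ mass-gap ∕ Clay: the Yang–Mills mass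
gap is NOT proved here or by anything this file feeds.  No `sorry`, no `def`, no `instance`, no `notation`.
-/

noncomputable section

open NormedSpace Metric Set Filter Topology
open Complex (I)

namespace Literature.MathematicalPhysics.QuantumFieldTheory.Balaban1983to89.B8Prop5GaugeParamKLevelSrcPer

open MatrixLog (mlog)
open B7Prop1Explicit (e U1)
open B7Prop2Explicit (unitaryUnits mem_unitaryUnits unitaryUnits_le_U1)
open B7Eq78Linearization (conjR)
open B8Ineq132 (covDerivFwd covDeriv norm_conjR)
open B8Eq138LandauZd (covLap covDivB)
open B8LambdaSpaceKLevel (wt wt_pos wt_nonneg lamSubK lamOf lamOf_sub norm_lamOf_le weight_mul_norm_covDerivFwd_le mkLam lamOf_mkLam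
  norm_mkLam_le norm_le_iff norm_sub_le_iff covDerivFwd_add' covDerivFwd_sub')
open B8Prop5ContractionKLevel (Bd2 Zsol Vop Wsrc PsiP5 Mc Kc mWc KWc covDeriv_sub')
open B8Prop5ContractionKLevelPer (propFive_fixedPoint_kLevel_per propFive_fixedPoint_kLevel_spec_per propFive_fixedPoint_kLevel_selfAdjoint_per
  propFive_fixedPoint_kLevel_traceFree_per)
open B8Prop5GaugeParamKLevel (norm_covDeriv_eq isSelfAdjoint_covLap)
open B8Prop5GaugeParamTraceFree (apply_covLap)

-- `Site` alone could resolve to the torus sites of `Setup.lean`; re-export the `ℤ^d` sites of `B7Prop1Explicit`.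
export B7Prop1Explicit (Site)
open B8Prop5ContractionKLevelSrc (PsiP5src)
open B8Prop5ContractionKLevelSrcPer (propFive_fixedPoint_kLevel_src_per propFive_fixedPoint_kLevel_src_spec_per
  propFive_fixedPoint_kLevel_src_selfAdjoint_per)
open B8Prop5GaugeParamKLevelPer (gpar_size_at gpar_grad_at gpar_lip_at)

variable {d : ℕ} {𝔸 : Type*} [CStarAlgebra 𝔸] [Nontrivial 𝔸]

section GaugeParam

variable {L k : ℕ} {η : ℝ} {Ω : ℕ → Set (Site d)} {Eb : ℕ → Set (Site d × Fin d)} {U₀ : Site d → Fin d → 𝔸ˣ}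
  {A : Site d → Fin d → 𝔸} {DA : Site d → 𝔸}

/-- ★ **PROPOSITION 5's GAUGE PARAMETER WITH A SOURCE (Theorem 8's (1.146)), ON THE TORUS** — `B8Prop5GaugeParamKLevelPer.gaugeParam_kLevel_per`
VERBATIM (the `H_c`-hypotheses at periodic `λ` only, `H_c`, `G′` periodic-valued, the fixed point on the closed set of periodic configurations —
`B8Prop5ContractionKLevelSrcPer.propFive_fixedPoint_kLevel_src_per` ∕ `_spec_per` ∕ `_selfAdjoint_per`, lit-balaban-p21 p660027) with
`B8Prop5GaugeParamKLevelSrc.gaugeParam_kLevel_src`'s source delta: a fixed Hermitian `f` with `Bd2`-size `m_f` on the `Ω_j`, the smallness (1.103)∕(1.106)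
read at `h₂ + m_f∕2`, the contraction `Ψ_src` and the Neumann identity with `W − f`.  Conclusion: the periodic fixed point `λ_s`, `λ′ = λ_s + H_cλ_s` periodic
with `‖λ′‖ ≤ α₄`, Hermitian, `= 0` off `Ω₀`, and the (1.100)-identity `Z + V(RZ) = W − f` on the `Ω_j`.
[cite: Balaban1985RegularSpaces, Prop. 5 (1.107)–(1.108) p.94, (1.100)–(1.103) p.93, Thm 8 (1.146) p.101, (1.17) p.78, §3 p.98] -/
theorem gaugeParam_kLevel_src_per (hL : 1 ≤ L) (hη : 0 < η) (hU₀ : ∀ x κ, U₀ x κ ∈ unitaryUnits 𝔸) (P : ℤ)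
    (hEbΩ : ∀ j, j ≤ k → ∀ x ∈ Ω j, ∀ μ : Fin d, (x, μ) ∈ Eb j ∧ (x - e μ, μ) ∈ Eb j)
    (Gp R Hc : (Site d → 𝔸) → (Site d → 𝔸))
    {α₄ BG BR h₀ h₁ h₂ l₀ l₁ l₂ cA cDA : ℝ}
    (hα₄ : 0 ≤ α₄) (hBG : 0 ≤ BG) (hBR : 0 ≤ BR) (hh₀ : 0 ≤ h₀) (hh₂ : 0 ≤ h₂) (hl₀ : 0 ≤ l₀) (hl₁ : 0 ≤ l₁)
    (hl₂ : 0 ≤ l₂) (hcA : 0 ≤ cA) (hcA' : cA ≤ 1 / 13) (hcDA : 0 ≤ cDA)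
    (ha₁' : α₄ / 4 + h₀ ≤ 1 / 24) (hb₁' : α₄ / 4 + h₁ ≤ 1 / 140) (hb₁ : 0 < α₄ / 4 + h₁) (hθ : 10 * (α₄ / 4 + h₀) * BR ≤ 1 / 2)
    (hh₀' : h₀ ≤ 3 * α₄ / 4) (hh₁' : h₁ ≤ 3 * α₄ / 4)
    -- letters
    (hG : ∀ (f : Site d → 𝔸) (m : ℝ), 0 ≤ m → Bd2 L η k Ω f m →
      (∀ x, ‖Gp f x‖ ≤ BG * m) ∧ ∀ j, j ≤ k → ∀ p ∈ Eb j, wt L η j * ‖covDerivFwd η U₀ p.2 (Gp f) p.1‖ ≤ BG * m)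
    (hGsub : ∀ f g : Site d → 𝔸, Gp (f - g) = Gp f - Gp g)
    (hGper : ∀ (f : Site d → 𝔸) (z : Site d) (i : Fin d), Gp f (z + P • e i) = Gp f z)
    (hGsupp : ∀ (f : Site d → 𝔸) (x : Site d), x ∉ Ω 0 → Gp f x = 0)
    (hGreal : ∀ f : Site d → 𝔸, (∀ j, j ≤ k → ∀ x ∈ Ω j, IsSelfAdjoint (f x)) → ∀ x, IsSelfAdjoint (Gp f x))
    (hRsub : ∀ f g : Site d → 𝔸, R (f - g) = R f - R g)
    (hRbd : ∀ (f : Site d → 𝔸) (m : ℝ), 0 ≤ m → Bd2 L η k Ω f m → Bd2 L η k Ω (R f) (BR * m))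
    (hRreal : ∀ f : Site d → 𝔸, (∀ j, j ≤ k → ∀ x ∈ Ω j, IsSelfAdjoint (f x)) → ∀ j, j ≤ k → ∀ x ∈ Ω j, IsSelfAdjoint (R f x))
    -- the Sect. E correction `H_c` (λ′ = λ + H_c λ)
    (hc0 : ∀ s : lamSubK η U₀ L k Eb, (∀ (z : Site d) (i : Fin d), lamOf s (z + P • e i) = lamOf s z) → ‖s‖ ≤ α₄ / 4 →
      ∀ x, ‖Hc (lamOf s) x‖ ≤ h₀)
    (hc1 : ∀ s : lamSubK η U₀ L k Eb, (∀ (z : Site d) (i : Fin d), lamOf s (z + P • e i) = lamOf s z) → ‖s‖ ≤ α₄ / 4 →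
      ∀ j, j ≤ k → ∀ p ∈ Eb j, wt L η j * ‖covDerivFwd η U₀ p.2 (Hc (lamOf s)) p.1‖ ≤ h₁)
    (hc2 : ∀ s : lamSubK η U₀ L k Eb, (∀ (z : Site d) (i : Fin d), lamOf s (z + P • e i) = lamOf s z) → ‖s‖ ≤ α₄ / 4 →
      Bd2 L η k Ω (covLap η U₀ (Hc (lamOf s))) h₂)
    (hcL0 : ∀ s t : lamSubK η U₀ L k Eb, (∀ (z : Site d) (i : Fin d), lamOf s (z + P • e i) = lamOf s z) → (∀ (z : Site d) (i : Fin d), lamOf t (z + P • e i) = lamOf t z) →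
      ‖s‖ ≤ α₄ / 4 → ‖t‖ ≤ α₄ / 4 → ∀ x, ‖Hc (lamOf s) x - Hc (lamOf t) x‖ ≤ l₀ * ‖s - t‖)
    (hcL1 : ∀ s t : lamSubK η U₀ L k Eb, (∀ (z : Site d) (i : Fin d), lamOf s (z + P • e i) = lamOf s z) → (∀ (z : Site d) (i : Fin d), lamOf t (z + P • e i) = lamOf t z) →
      ‖s‖ ≤ α₄ / 4 → ‖t‖ ≤ α₄ / 4 → ∀ j, j ≤ k → ∀ p ∈ Eb j,
      wt L η j * ‖covDerivFwd η U₀ p.2 (Hc (lamOf s) - Hc (lamOf t)) p.1‖ ≤ l₁ * ‖s - t‖)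
    (hcL2 : ∀ s t : lamSubK η U₀ L k Eb, (∀ (z : Site d) (i : Fin d), lamOf s (z + P • e i) = lamOf s z) → (∀ (z : Site d) (i : Fin d), lamOf t (z + P • e i) = lamOf t z) →
      ‖s‖ ≤ α₄ / 4 → ‖t‖ ≤ α₄ / 4 → Bd2 L η k Ω (covLap η U₀ (Hc (lamOf s)) - covLap η U₀ (Hc (lamOf t))) (l₂ * ‖s - t‖))
    (hcsa : ∀ s : lamSubK η U₀ L k Eb, (∀ (z : Site d) (i : Fin d), lamOf s (z + P • e i) = lamOf s z) → ‖s‖ ≤ α₄ / 4 →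
      (∀ x, IsSelfAdjoint (lamOf s x)) → ∀ x, IsSelfAdjoint (Hc (lamOf s) x))
    (hcsupp : ∀ s : lamSubK η U₀ L k Eb, (∀ (z : Site d) (i : Fin d), lamOf s (z + P • e i) = lamOf s z) → ‖s‖ ≤ α₄ / 4 →
      ∀ x, x ∉ Ω 0 → Hc (lamOf s) x = 0)
    (hcper : ∀ s : lamSubK η U₀ L k Eb, (∀ (z : Site d) (i : Fin d), lamOf s (z + P • e i) = lamOf s z) → ‖s‖ ≤ α₄ / 4 →
      ∀ (z : Site d) (i : Fin d), Hc (lamOf s) (z + P • e i) = Hc (lamOf s) z)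
    -- the datum
    (hDA : Bd2 L η k Ω DA cDA) (hDAsa : ∀ j, j ≤ k → ∀ x ∈ Ω j, IsSelfAdjoint (DA x))
    (hA : ∀ j, j ≤ k → ∀ x ∈ Ω j, ∀ μ : Fin d,
      wt L η j * ‖A x μ‖ ≤ cA ∧ wt L η j * ‖conjR (U₀ (x - e μ) μ)⁻¹ (A (x - e μ) μ)‖ ≤ cA)
    (hAsa : ∀ x μ, IsSelfAdjoint (A x μ))
    -- THE SOURCE of Theorem 8's (1.146): a fixed function with finite `|f|₍₋₂₎` on the `Ω_j`, Hermitian there (print: «f from the space R(U₀)»)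
    {f : Site d → 𝔸} {mf : ℝ} (hmf : 0 ≤ mf) (hf : Bd2 L η k Ω f mf) (hfsa : ∀ j, j ≤ k → ∀ x ∈ Ω j, IsSelfAdjoint (f x))
    -- smallness (1.103)/(1.106) on the explicit constants of the contraction, READ AT `h₂ + m_f∕2` (the source's size booked in the `mE` slot)
    (h103 : BG * Mc d BR (α₄ / 4 + h₁) cA (h₂ + mf / 2) cDA ≤ α₄ / 4)
    (h106 : BG * Kc d BR (α₄ / 4 + h₁) cA (h₂ + mf / 2) cDA l₂ (1 + l₀) (1 + l₁) ≤ 1 / 2) :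
    ∃ s s' : lamSubK η U₀ L k Eb,
      (∀ (z : Site d) (i : Fin d), lamOf s (z + P • e i) = lamOf s z) ∧ (∀ (z : Site d) (i : Fin d), lamOf s' (z + P • e i) = lamOf s' z) ∧
      ‖s‖ ≤ α₄ / 4 ∧
      lamOf s = Gp (PsiP5src η U₀ A DA f R (fun lam => lam + Hc lam) (fun lam => covLap η U₀ (Hc lam)) (lamOf s)) ∧
      lamOf s' = lamOf s + Hc (lamOf s) ∧ ‖s'‖ ≤ α₄ ∧ (∀ x, IsSelfAdjoint (lamOf s' x)) ∧ (∀ x, x ∉ Ω 0 → lamOf s' x = 0) ∧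
      (∀ j, j ≤ k → ∀ x ∈ Ω j,
        Zsol (Wsrc η U₀ A DA (lamOf s') (covLap η U₀ (Hc (lamOf s))) - f) (Vop (lamOf s')) R x +
          Vop (lamOf s') (R (Zsol (Wsrc η U₀ A DA (lamOf s') (covLap η U₀ (Hc (lamOf s))) - f) (Vop (lamOf s')) R)) x =
        Wsrc η U₀ A DA (lamOf s') (covLap η U₀ (Hc (lamOf s))) x - f x) := by
  set gpar : (Site d → 𝔸) → (Site d → 𝔸) := fun lam => lam + Hc lam with hgpar
  set Eterm : (Site d → 𝔸) → (Site d → 𝔸) := fun lam => covLap η U₀ (Hc lam) with hEterm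
  -- the displayed hypotheses of the contraction at (gpar, Eterm)
  have hg0 : ∀ s : lamSubK η U₀ L k Eb, (∀ (z : Site d) (i : Fin d), lamOf s (z + P • e i) = lamOf s z) → ‖s‖ ≤ α₄ / 4 →
      ∀ j, j ≤ k → ∀ x ∈ Ω j, ‖gpar (lamOf s) x‖ ≤ α₄ / 4 + h₀ :=
    fun s hp hs j _ x _ => gpar_size_at s hs (hc0 s hp hs) x
  have hg1 : ∀ s : lamSubK η U₀ L k Eb, (∀ (z : Site d) (i : Fin d), lamOf s (z + P • e i) = lamOf s z) → ‖s‖ ≤ α₄ / 4 → ∀ j, j ≤ k → ∀ x ∈ Ω j, ∀ μ : Fin d,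
      wt L η j * ‖covDerivFwd η U₀ μ (gpar (lamOf s)) x‖ ≤ α₄ / 4 + h₁ ∧ wt L η j * ‖covDeriv η U₀ μ (gpar (lamOf s)) x‖ ≤ α₄ / 4 + h₁ :=
    fun s hp hs j hj x hx μ => gpar_grad_at hη hU₀ hEbΩ s hs (hc1 s hp hs) hj hx μ
  have hgL : ∀ s t : lamSubK η U₀ L k Eb, (∀ (z : Site d) (i : Fin d), lamOf s (z + P • e i) = lamOf s z) → (∀ (z : Site d) (i : Fin d), lamOf t (z + P • e i) = lamOf t z) →
      ‖s‖ ≤ α₄ / 4 → ‖t‖ ≤ α₄ / 4 → ∀ j, j ≤ k → ∀ x ∈ Ω j,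
      ‖gpar (lamOf s) x - gpar (lamOf t) x‖ ≤ (1 + l₀) * ‖s - t‖ ∧ ∀ μ : Fin d,
        wt L η j * ‖covDerivFwd η U₀ μ (gpar (lamOf s) - gpar (lamOf t)) x‖ ≤ (1 + l₁) * ‖s - t‖ ∧
        wt L η j * ‖covDeriv η U₀ μ (gpar (lamOf s) - gpar (lamOf t)) x‖ ≤ (1 + l₁) * ‖s - t‖ :=
    fun s t hps hpt hs ht j hj x hx => gpar_lip_at hη hU₀ hEbΩ s t (hcL0 s t hps hpt hs ht) (hcL1 s t hps hpt hs ht) hj hx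
  have hE0 : ∀ s : lamSubK η U₀ L k Eb, (∀ (z : Site d) (i : Fin d), lamOf s (z + P • e i) = lamOf s z) → ‖s‖ ≤ α₄ / 4 → Bd2 L η k Ω (Eterm (lamOf s)) h₂ :=
    fun s hp hs => hc2 s hp hs
  have hEL : ∀ s t : lamSubK η U₀ L k Eb, (∀ (z : Site d) (i : Fin d), lamOf s (z + P • e i) = lamOf s z) → (∀ (z : Site d) (i : Fin d), lamOf t (z + P • e i) = lamOf t z) →
      ‖s‖ ≤ α₄ / 4 → ‖t‖ ≤ α₄ / 4 → Bd2 L η k Ω (Eterm (lamOf s) - Eterm (lamOf t)) (l₂ * ‖s - t‖) :=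
    fun s t hps hpt hs ht => hcL2 s t hps hpt hs ht
  -- the fixed point (on the periodic configurations)
  obtain ⟨s, hp, hs, hfix, -⟩ := propFive_fixedPoint_kLevel_src_per (Ω := Ω) (Eb := Eb) (U₀ := U₀) (A := A) (DA := DA) (f := f) hL hη P Gp R
    gpar Eterm hα₄ hBG hBR (by positivity) ha₁' hb₁ hb₁' hcA hcA' hcDA hh₂ hl₂ (by positivity) (by positivity) hmf hθ hG hGsub hGper hRsub hRbd
    hg0 hg1 hgL hE0 hEL hDA hf hA h103 h106
  obtain ⟨hN, -, -, hoff⟩ := propFive_fixedPoint_kLevel_src_spec_per (Ω := Ω) (Eb := Eb) (U₀ := U₀) (A := A) (DA := DA) (f := f) hL hη P Gp R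
    gpar Eterm hBR (by positivity) ha₁' hb₁ hb₁' hcA hcA' hcDA hh₂ hmf hθ hG hGsupp hRsub hRbd hg0 hg1 hE0 hDA hf hA hp hs hfix
  -- reality
  have hgsa : ∀ t : lamSubK η U₀ L k Eb, (∀ (z : Site d) (i : Fin d), lamOf t (z + P • e i) = lamOf t z) → ‖t‖ ≤ α₄ / 4 →
      (∀ x, IsSelfAdjoint (lamOf t x)) → ∀ x, IsSelfAdjoint (gpar (lamOf t) x) :=
    fun t hpt ht hsa x => (hsa x).add (hcsa t hpt ht hsa x)
  have hEsa : ∀ t : lamSubK η U₀ L k Eb, (∀ (z : Site d) (i : Fin d), lamOf t (z + P • e i) = lamOf t z) → ‖t‖ ≤ α₄ / 4 →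
      (∀ x, IsSelfAdjoint (lamOf t x)) → ∀ j, j ≤ k → ∀ x ∈ Ω j, IsSelfAdjoint (Eterm (lamOf t) x) :=
    fun t hpt ht hsa j _ x _ => isSelfAdjoint_covLap hU₀ (hcsa t hpt ht hsa) x
  have hsa : ∀ x, IsSelfAdjoint (lamOf s x) :=
    propFive_fixedPoint_kLevel_src_selfAdjoint_per (Ω := Ω) (Eb := Eb) (U₀ := U₀) (A := A) (DA := DA) (f := f) hL hη hU₀ P Gp R gpar
      Eterm hα₄ hBG hBR (by positivity) ha₁' hb₁ hb₁' hcA hcA' hcDA hh₂ hl₂ (by positivity) (by positivity) hmf hθ hG hGsub hGper hRsub hRbd hg0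
      hg1 hgL hE0 hEL hDA hf hA h103 h106 hAsa hDAsa hfsa hgsa hEsa hRreal hGreal hp hs hfix
  -- the gauge parameter as a point of the λ-space
  have hb_lam : ∀ x, ‖gpar (lamOf s) x‖ ≤ α₄ := fun x => by
    have := gpar_size_at s hs (hc0 s hp hs) x; simp only [hgpar] at this ⊢; linarith
  have hb_grad : ∀ j, j ≤ k → ∀ p ∈ Eb j, wt L η j * ‖covDerivFwd η U₀ p.2 (gpar (lamOf s)) p.1‖ ≤ α₄ := by
    intro j hj p hp'
    have hw : 0 ≤ wt L η j := wt_nonneg L hη.le j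
    simp only [hgpar]
    rw [covDerivFwd_add']
    calc wt L η j * ‖covDerivFwd η U₀ p.2 (lamOf s) p.1 + covDerivFwd η U₀ p.2 (Hc (lamOf s)) p.1‖
        ≤ wt L η j * (‖covDerivFwd η U₀ p.2 (lamOf s) p.1‖ + ‖covDerivFwd η U₀ p.2 (Hc (lamOf s)) p.1‖) :=
          mul_le_mul_of_nonneg_left (norm_add_le _ _) hw
      _ ≤ α₄ / 4 + h₁ := by rw [mul_add]; exact add_le_add ((weight_mul_norm_covDerivFwd_le hη.le s hj hp').trans hs) (hc1 s hp hs j hj p hp')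
      _ ≤ α₄ := by linarith
  set s' : lamSubK η U₀ L k Eb := mkLam hη.le (gpar (lamOf s)) hb_lam hb_grad with hs'def
  have hs'lam : lamOf s' = gpar (lamOf s) := lamOf_mkLam hη.le _ hb_lam hb_grad
  refine ⟨s, s', hp, ?_, hs, hfix, hs'lam, ?_, ?_, ?_, ?_⟩
  · intro z i
    rw [hs'lam]; simp only [hgpar, Pi.add_apply]
    rw [hp z i, hcper s hp hs z i]
  · exact (norm_mkLam_le hη.le _ hb_lam hb_grad).trans (max_le le_rfl le_rfl)
  · intro x; rw [hs'lam]; exact hgsa s hp hs hsa x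
  · intro x hx
    rw [hs'lam]; simp only [hgpar, Pi.add_apply]
    rw [hoff x hx, hcsupp s hp hs x hx, add_zero]
  · intro j hj x hx
    rw [hs'lam]
    exact hN j hj x hx

end GaugeParam

#print axioms gaugeParam_kLevel_src_per

end Literature.MathematicalPhysics.QuantumFieldTheory.Balaban1983to89.B8Prop5GaugeParamKLevelSrcPer

end
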